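import Summits.CriticalPhenomena.CardyFormulaZ2.Theses.CardyBoundaryCoulombGas
import Summits.CriticalPhenomena.CardyFormulaZ2.Theorems.CardyBoundaryCoulombGasStripClusterRatesBetheKernelToolkit
import Summits.CriticalPhenomena.CardyFormulaZ2.Theorems.CardyBoundaryCoulombGasStripClusterRatesBetheMapInjOn

/-!
# Total mass of the Bethe scattering kernel
# (line `two-cluster-rate-is-stationary-gap`, crux `StripClusterRates`,
# stmt-CriticalPhenomena-13878)

Condensation building block for the Bethe-asymptotics pillar: the scattering kernel
`G'(x) = (√3/2)/(cosh 2x + 1/2)` of the ground-state Bethe equations of the open staggered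
Temperley–Lieb(1) chain at `γ = π/3` (the derivative of the scattering phase
`G(x) = arctan(tanh x/√3)`, `bu_hasDerivAt_G`) is positive, integrable on `ℝ`, and has total mass
`∫_ℝ G' = G(+∞) - G(-∞) = π/6 - (-π/6) = π/3`.
After dividing by `π`, the mass `1/3` is the contraction constant of the linearised Bethe
equations.

Proof. Positivity: `cosh ≥ 1`. Integrability on `(0, ∞)`: a nonnegative derivative of a function
with a limit at `+∞` is integrable (`MeasureTheory.integrableOn_Ioi_deriv_of_nonneg'` with
`G → π/6`, `bk_G_tendsto_atTop`); the kernel is even (`bu_kernel_even`), so reflecting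
(`IntegrableOn.comp_neg_Iic`) gives integrability on `(-∞, 0]`, hence on `ℝ`. The value: FTC-2 on
the whole line (`MeasureTheory.integral_of_hasDerivAt_of_tendsto`) with the limits `G → π/6` at
`+∞` and, by oddness (`bk_G_neg`), `G → -π/6` at `-∞`.
-/

noncomputable section

namespace Summit.CriticalPhenomena.CardyFormulaZ2.Cruxes.StripClusterRates.TwoClusterRateIsStationaryGap

open Filter Topology MeasureTheory Set

/-- The scattering kernel is positive: `0 < (√3/2)/(cosh 2x + 1/2)`. [folklore] -/
theorem bu_kernel_pos (x : ℝ) : 0 < Real.sqrt 3 / 2 / (Real.cosh (2 * x) + 1 / 2) := by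
  have hcosh : 1 ≤ Real.cosh (2 * x) := Real.one_le_cosh (2 * x)
  have hd : 0 < Real.cosh (2 * x) + 1 / 2 := by linarith
  have hs : 0 < Real.sqrt 3 := Real.sqrt_pos.2 (by norm_num)
  positivity

/-- The scattering phase tends to `-π/6` at `-∞` (oddness and `G → π/6` at `+∞`). [folklore] -/
theorem bu_G_tendsto_atBot :
    Tendsto (fun x : ℝ ↦ Real.arctan (Real.tanh x / Real.sqrt 3)) atBot (𝓝 (-(Real.pi / 6))) := by
  have h := (bk_G_tendsto_atTop.comp tendsto_neg_atBot_atTop).neg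
  refine h.congr fun x => ?_
  simp only [Function.comp_apply, bk_G_neg, neg_neg]

/-- The scattering kernel is integrable on every right half-line `(a, ∞)`: it is the nonnegative
derivative of `G`, which has a limit at `+∞`. [folklore] -/
theorem bu_kernel_integrableOn_Ioi (a : ℝ) :
    IntegrableOn (fun x : ℝ ↦ Real.sqrt 3 / 2 / (Real.cosh (2 * x) + 1 / 2)) (Ioi a) :=
  integrableOn_Ioi_deriv_of_nonneg' (fun x _ => bu_hasDerivAt_G x)
    (fun x _ => (bu_kernel_pos x).le) bk_G_tendsto_atTop

/-- The scattering kernel is integrable on `ℝ` (right half-line plus its reflection, the kernel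
being even). [folklore] -/
theorem bu_kernel_integrable :
    Integrable (fun x : ℝ ↦ Real.sqrt 3 / 2 / (Real.cosh (2 * x) + 1 / 2)) := by
  have hIoi := bu_kernel_integrableOn_Ioi 0
  have hIci : IntegrableOn (fun x : ℝ ↦ Real.sqrt 3 / 2 / (Real.cosh (2 * x) + 1 / 2))
      (Ici (-0)) := by
    rw [neg_zero, integrableOn_Ici_iff_integrableOn_Ioi]
    exact hIoi
  have hIic : IntegrableOn (fun x : ℝ ↦ Real.sqrt 3 / 2 / (Real.cosh (2 * x) + 1 / 2))
      (Iic 0) := by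
    refine hIci.comp_neg_Iic.congr_fun (fun x _ => ?_) measurableSet_Iic
    exact bu_kernel_even x
  have h := hIic.union hIoi
  rwa [Iic_union_Ioi, integrableOn_univ] at h

/-- **Kernel mass** (registered stub `bu_kernel_integral`): `∫_ℝ (√3/2)/(cosh 2x + 1/2) dx = π/3`,
the kernel is integrable on `ℝ`, and it is positive. FTC-2 on the whole line for
`G(x) = arctan(tanh x/√3)` with `G(±∞) = ±π/6`. [folklore] -/
theorem bu_kernel_integral : (∫ x : ℝ, Real.sqrt 3 / 2 / (Real.cosh (2 * x) + 1 / 2)) = Real.pi / 3 ∧ MeasureTheory.Integrable (fun x : ℝ ↦ Real.sqrt 3 / 2 / (Real.cosh (2 * x) + 1 / 2)) ∧ ∀ x : ℝ, 0 < Real.sqrt 3 / 2 / (Real.cosh (2 * x) + 1 / 2) := by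
  refine ⟨?_, bu_kernel_integrable, bu_kernel_pos⟩
  have h := integral_of_hasDerivAt_of_tendsto
    (f' := fun x : ℝ ↦ Real.sqrt 3 / 2 / (Real.cosh (2 * x) + 1 / 2))
    bu_hasDerivAt_G bu_kernel_integrable bu_G_tendsto_atBot bk_G_tendsto_atTop
  rw [h]
  ring

end Summit.CriticalPhenomena.CardyFormulaZ2.Cruxes.StripClusterRates.TwoClusterRateIsStationaryGap

end
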